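import Mathlib
import HarnessLib
import Summits.RiemannHypothesis.RiemannHypothesis.Theorems.EarlyAppointmentsRemainder0XiStubFarLogKernelSharp
import Summits.RiemannHypothesis.RiemannHypothesis.Theorems.EarlyAppointmentsRemainder0XiRho2V4Objects

/-!
# ⟨24730⟩ ρ2 v4 stub 2 — `FarLogKernelSharp4` CLOSED: |MAIN(x)| ≤ (η₀ − 3/10)/s(γ) on the box, γ > T_PT

C4 «kernel desk» rh-idea-6 g30, director (CA406)(b).  SUPPORT module, fully proved (no `sorry`), standard axioms.
Imports the (CA402) image (2) `…StubFarLogKernelSharp` (§A `RegistryForm`: `T_PT_half_lt_of_box`, `smallTerm_le`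
(191·log x/x ≤ 1/1000 for x > T_PT/2), `log_div_twoPi_ge` (26 ≤ log(γ/2π)); it imports image (1) `…ArtanhBound` with
★ `farLogKernelSharp_asymptotic` : |MAIN(x) + π/4| ≤ log x·(135 + 4·lowStart)/x for x > T_PT/2) and the v4 objects mirror.
New arithmetic: `π/4 + 1/1000 ≤ (eta0 − errorBudget4)/xiSpacing γ = (1/5)·log(γ/2π)/(2π)` for γ > T_PT
(⟸ 2π(π/4 + 1/1000) = π²/2 + π/500 < 4.97 ≤ 5.2 ≤ L/5 with L ≥ 26; `Real.pi_lt_d2`).  Director's check (CA406):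
(π/4 + 191·log x/x)·s(γ) ≤ 0.7854·0.2417 + 10⁻⁸ ≤ 0.19 ≤ η₀ − errorBudget4 = 0.2 ✓ (s(γ) = 2π/L ≤ 2π/26).
★ `Rho2V4.stub_farLogKernelSharp4 : FarLogKernelSharp4` — the v4 registry stub 2 BY NAME (Theorems-side mirror of the
Prop, byte-identical body) and `stub_farLogKernelSharp4_text` — the same spelled verbatim.
Nothing here bears on the truth of RH; RH is not proved; 24730 OPEN.
-/

set_option linter.dupNamespace false

namespace Summit.RiemannHypothesis.RiemannHypothesis.Theorems.EarlyAppointmentsRemainder0Xi.RegistryForm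

open Real Set
open Summit.RiemannHypothesis.RiemannHypothesis.Cruxes.Remainder0Xi.Rho2V2
open Summit.RiemannHypothesis.RiemannHypothesis.Cruxes.Remainder0Xi.Rho2V4 (errorBudget4)

/-- (K) the v4 right-hand side dominates `π/4 + 1/1000` above the Platt–Trudgian height:
`π/4 + 1/1000 ≤ (1/2 − 3/10) · log(γ/2π) / (2π)` for `γ > T_PT` (uses `26 ≤ log(γ/2π)` and `π < 3.15`). -/
theorem registryRhs4_ge {γ : ℝ} (hγ : T_PT < γ) :
    Real.pi / 4 + 1 / 1000 ≤ (eta0 - errorBudget4) / xiSpacing γ := by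
  have h2pi : 0 < 2 * Real.pi := by positivity
  have hL := log_div_twoPi_ge hγ
  have hE0 : eta0 = 1 / 2 := rfl
  have hE4 : errorBudget4 = 3 / 10 := rfl
  rw [hE0, hE4]
  unfold xiSpacing
  rw [div_div_eq_mul_div, le_div_iff₀ h2pi]
  have hpi := Real.pi_lt_d2
  have hpi0 := Real.pi_pos
  nlinarith [mul_lt_mul'' hpi hpi hpi0.le hpi0.le]

/-- **v4 registry form from the asymptotic form**:
`(∀ x > T_PT/2, |MAIN(x) + π/4| ≤ 191·log x/x) → ∀ γ > T_PT, ∀ x, |x − γ| ≤ 67.5 → |MAIN(x)| ≤ (η₀ − errorBudget4)/s(γ)`. -/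
theorem registry4_of_asymptotic
    (h : Summit.RiemannHypothesis.RiemannHypothesis.Cruxes.Remainder0Xi.Rho2V2.FarLogKernelSharp) :
    ∀ γ : ℝ, T_PT < γ → ∀ x : ℝ, |x - γ| ≤ boxHalfWidth →
      |mainIntegral x| ≤ (eta0 - errorBudget4) / xiSpacing γ := by
  intro γ hγ x hx
  have hxT : T_PT / 2 < x := T_PT_half_lt_of_box hγ hx
  have hmain : |mainIntegral x + Real.pi / 4| ≤ Real.log x * (135 + 4 * lowStart) / x := h x hxT
  have hsmall := smallTerm_le hxT
  have hrhs := registryRhs4_ge hγ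
  have htri : |mainIntegral x| ≤ |mainIntegral x + Real.pi / 4| + Real.pi / 4 := by
    have h1 := abs_sub (mainIntegral x + Real.pi / 4) (Real.pi / 4)
    have hpi : |Real.pi / 4| = Real.pi / 4 := abs_of_pos (by positivity)
    rw [add_sub_cancel_right, hpi] at h1
    exact h1
  linarith

end Summit.RiemannHypothesis.RiemannHypothesis.Theorems.EarlyAppointmentsRemainder0Xi.RegistryForm

namespace Summit.RiemannHypothesis.RiemannHypothesis.Cruxes.Remainder0Xi.Rho2V4

open Summit.RiemannHypothesis.RiemannHypothesis.Cruxes.Remainder0Xi.Rho2V2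
  (T_PT xiSpacing boxHalfWidth eta0 lowStart mainIntegral)
open Summit.RiemannHypothesis.RiemannHypothesis.Theorems.EarlyAppointmentsRemainder0Xi

/-- ★ ⟨24730⟩ v4 STUB 2 CLOSED, BY NAME: `FarLogKernelSharp4` (Theorems-side mirror of the registry Prop). -/
theorem stub_farLogKernelSharp4 : FarLogKernelSharp4 :=
  RegistryForm.registry4_of_asymptotic ArtanhBound.farLogKernelSharp_asymptotic

/-- ★ the same, spelled as the registry text of `Lines/rho2_v4.lean` verbatim. -/
theorem stub_farLogKernelSharp4_text :
    ∀ γ : ℝ, T_PT < γ → ∀ x : ℝ, |x - γ| ≤ boxHalfWidth →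
      |mainIntegral x| ≤ (eta0 - errorBudget4) / xiSpacing γ :=
  stub_farLogKernelSharp4

end Summit.RiemannHypothesis.RiemannHypothesis.Cruxes.Remainder0Xi.Rho2V4
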